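import Literature.MathematicalPhysics.QuantumLattice.InfVolFermionStateWeakLimits
import Mathlib.Analysis.Convex.Deriv
import HarnessLib

/-!
# The conjugate density of the translation-invariant ground states of a pencil `Ψ₀ + sΨ₁` fills exactly
# the interval `[∂⁺e₀(s), ∂⁻e₀(s)]` of one-sided derivatives of the ground-state energy density — both
# endpoints ATTAINED; at a differentiability point all ground states agree

Topic `Literature/MathematicalPhysics/QuantumLattice` (namespace = path). Sequel of
`TIGroundEnergyDensityResponse.lean` (hubbard-fast-lit: the pencil `pencil Ψ₀ Ψ₁ s`, the concave
variational ground-state energy density `e₀(s) := tiGroundEnergyDensity (pencil Ψ₀ Ψ₁ s) R`, the secant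
brackets of the conjugate density `e_{Ψ₁}(ω)` of a minimiser) and of `InfVolFermionStateWeakLimits.lean`
(hubbard-cq-p5: sequential weak-⋆ compactness, existence of minimisers, limits of minimisers along a pencil).
Written for the Hubbard cuprate cell (`hubbard-cq`, rung CQ, row PC-a): with `Ψ₁ = −(pair source)` this is
the statement that Koma–Tasaki's quasi-average order parameter `−∂⁺e_src(0)` is the LARGEST pair amplitude
of a translation-invariant infinite-volume ground state, and is attained (`DWaveOrderParameterInfiniteVolume.lean`).
Everything is PROVED; no definition, no named fact, zero compute.

## Results (`f s := (pencil Ψ₀ Ψ₁ s).tiGroundEnergyDensity R`, concave on `ℝ`; `b(ω) := ω.meanEnergy Ψ₁ R`)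

* `FermionInteraction.hasDerivWithinAt_Ioi_Iio_tiGroundEnergyDensity_pencil`: the one-sided derivatives
  `∂⁺f(σ) = derivWithin f (Ioi σ) σ`, `∂⁻f(σ) = derivWithin f (Iio σ) σ` exist at every `σ`, `∂⁺f ≤ ∂⁻f`,
  and the slopes `slope f σ` tend to them from the right / left
  (`tendsto_slope_nhdsGT/LT_tiGroundEnergyDensity_pencil`).
* RANGE (`IsMeanEnergyMinimiser.rightDeriv_le_meanEnergy`, `….meanEnergy_le_leftDeriv`): every
  minimiser `ω` of the mean energy of `Ψ₀ + σΨ₁` has `∂⁺f(σ) ≤ b(ω) ≤ ∂⁻f(σ)` (its conjugate density is a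
  supergradient of the concave `f` at `σ`; Israel's tangent-functional picture at `T = 0`).
* ATTAINED (`FermionInteraction.exists_isMeanEnergyMinimiser_meanEnergy_eq_rightDeriv` / `…_leftDeriv`):
  there are minimisers `ω₊, ω₋` at `σ` with `b(ω₊) = ∂⁺f(σ)` and `b(ω₋) = ∂⁻f(σ)` — weak-⋆ limits of minimisers
  at couplings `σ ± 1/(n+1)`, whose conjugate densities are squeezed between two secant slopes tending to
  the one-sided derivative; hence `IsLeast` / `IsGreatest` statements for the set of conjugate densities.
* UNIQUENESS AT SMOOTH POINTS (`IsMeanEnergyMinimiser.meanEnergy_eq_of_hasDerivAt`): if `f` is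
  differentiable at `σ` with derivative `f'`, every minimiser at `σ` has `b(ω) = f'`; conversely
  (`FermionInteraction.differentiableAt_tiGroundEnergyDensity_pencil_iff`) `f` is differentiable at `σ`
  iff all minimisers at `σ` have the same conjugate density (Griffiths: a kink of the ground-state energy
  density = coexistence of translation-invariant ground states with different conjugate densities).

## References
* R. B. Israel, *Convexity in the Theory of Lattice Gases* (1979), §II.1 eq. (1)–(2) (invariant
  equilibrium states as tangent functionals to the pressure; here the `T = 0` analogue along a line).
  [cite: Israel1979, §II.1 eq. (1)–(2)]
* R. B. Griffiths, Phys. Rev. 152 (1966) 240, §II (one-sided derivatives of a concave thermodynamic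
  function bound the conjugate variable). [cite: Griffiths1966, §II]
* T. Koma, H. Tasaki, J. Stat. Phys. 76 (1994) 745, §1 (order parameter `= −` derivative of the sourced
  ground-state energy density at `0⁺`). [cite: KomaTasaki1994, §1]

## What is NOT here
Nothing model-specific; no statement about finite-volume ground states or long-range order.
-/

noncomputable section

namespace Literature.MathematicalPhysics.QuantumLattice

open _root_.Filter Set
open scoped _root_.Topology

variable {d : ℕ}

/-! ### One-sided derivatives of the concave `e₀` along a pencil -/

namespace FermionInteraction

variable (Ψ₀ Ψ₁ : FermionInteraction d) (R : ℝ)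

/-- **One-sided derivatives of `s ↦ e₀(Ψ₀ + sΨ₁)` exist at every coupling** (concavity on `ℝ`; Mathlib's
one-sided differentiability of convex functions at interior points). [cite: Israel1979, §II.1 eq. (1)–(2)] -/
theorem hasDerivWithinAt_Ioi_Iio_tiGroundEnergyDensity_pencil (σ : ℝ) :
    HasDerivWithinAt (fun s => (pencil Ψ₀ Ψ₁ s).tiGroundEnergyDensity R)
        (derivWithin (fun s => (pencil Ψ₀ Ψ₁ s).tiGroundEnergyDensity R) (Ioi σ) σ) (Ioi σ) σ ∧
      HasDerivWithinAt (fun s => (pencil Ψ₀ Ψ₁ s).tiGroundEnergyDensity R)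
        (derivWithin (fun s => (pencil Ψ₀ Ψ₁ s).tiGroundEnergyDensity R) (Iio σ) σ) (Iio σ) σ := by
  have hc := (concaveOn_tiGroundEnergyDensity_pencil Ψ₀ Ψ₁ R).neg
  have hint : σ ∈ interior (Set.univ : Set ℝ) := by
    rw [interior_univ]
    exact Set.mem_univ σ
  have hR := (hc.differentiableWithinAt_Ioi_of_mem_interior hint).neg
  have hL := (hc.differentiableWithinAt_Iio_of_mem_interior hint).neg
  simp only [neg_neg] at hR hL
  exact ⟨hR.hasDerivWithinAt, hL.hasDerivWithinAt⟩

/-- **`∂⁺e₀(σ) ≤ ∂⁻e₀(σ)`** along every pencil (concavity). [cite: Israel1979, §II.1 eq. (1)–(2)] -/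
theorem rightDeriv_le_leftDeriv_tiGroundEnergyDensity_pencil (σ : ℝ) :
    derivWithin (fun s => (pencil Ψ₀ Ψ₁ s).tiGroundEnergyDensity R) (Ioi σ) σ ≤
      derivWithin (fun s => (pencil Ψ₀ Ψ₁ s).tiGroundEnergyDensity R) (Iio σ) σ := by
  have hc := (concaveOn_tiGroundEnergyDensity_pencil Ψ₀ Ψ₁ R).neg
  have hint : σ ∈ interior (Set.univ : Set ℝ) := by
    rw [interior_univ]
    exact Set.mem_univ σ
  have key := hc.leftDeriv_le_rightDeriv_of_mem_interior hint
  have e1 : (-fun s : ℝ => (pencil Ψ₀ Ψ₁ s).tiGroundEnergyDensity R) =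
      fun s : ℝ => -(pencil Ψ₀ Ψ₁ s).tiGroundEnergyDensity R := rfl
  rw [e1, derivWithin.fun_neg, derivWithin.fun_neg] at key
  linarith

/-- **Right slopes converge to the right derivative**: `slope e₀ σ t → ∂⁺e₀(σ)` as `t → σ⁺`.
[cite: Israel1979, §II.1 eq. (1)–(2)] -/
theorem tendsto_slope_nhdsGT_tiGroundEnergyDensity_pencil (σ : ℝ) :
    Tendsto (slope (fun s => (pencil Ψ₀ Ψ₁ s).tiGroundEnergyDensity R) σ) (𝓝[>] σ)
      (𝓝 (derivWithin (fun s => (pencil Ψ₀ Ψ₁ s).tiGroundEnergyDensity R) (Ioi σ) σ)) :=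
  (hasDerivWithinAt_iff_tendsto_slope' self_notMem_Ioi).1
    (hasDerivWithinAt_Ioi_Iio_tiGroundEnergyDensity_pencil Ψ₀ Ψ₁ R σ).1

/-- **Left slopes converge to the left derivative**: `slope e₀ σ t → ∂⁻e₀(σ)` as `t → σ⁻`.
[cite: Israel1979, §II.1 eq. (1)–(2)] -/
theorem tendsto_slope_nhdsLT_tiGroundEnergyDensity_pencil (σ : ℝ) :
    Tendsto (slope (fun s => (pencil Ψ₀ Ψ₁ s).tiGroundEnergyDensity R) σ) (𝓝[<] σ)
      (𝓝 (derivWithin (fun s => (pencil Ψ₀ Ψ₁ s).tiGroundEnergyDensity R) (Iio σ) σ)) :=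
  (hasDerivWithinAt_iff_tendsto_slope' self_notMem_Iio).1
    (hasDerivWithinAt_Ioi_Iio_tiGroundEnergyDensity_pencil Ψ₀ Ψ₁ R σ).2

/-- The two-step slope identity: `slope f (σ + δ) (σ + 2δ) = 2·slope f σ (σ + 2δ) − slope f σ (σ + δ)`
(`δ ≠ 0`). [folklore] -/
private theorem slope_two_step (f : ℝ → ℝ) (σ δ : ℝ) (hδ : δ ≠ 0) :
    slope f (σ + δ) (σ + 2 * δ) = 2 * slope f σ (σ + 2 * δ) - slope f σ (σ + δ) := by
  have h2 : (2 : ℝ) * δ ≠ 0 := mul_ne_zero two_ne_zero hδ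
  simp only [slope_def_field, show σ + 2 * δ - (σ + δ) = δ by ring, show σ + 2 * δ - σ = 2 * δ by ring,
    show σ + δ - σ = δ by ring]
  field_simp
  ring

end FermionInteraction

/-! ### The range of the conjugate density over minimisers -/

namespace InfVolFermionState

variable {Ψ₀ Ψ₁ : FermionInteraction d} {R σ : ℝ} {ω : InfVolFermionState d}

/-- Right slopes lie below the conjugate density of a minimiser: `slope e₀ σ t ≤ e_{Ψ₁}(ω)` for `σ < t`
(the supergradient inequality). [cite: Griffiths1966, §II] -/
theorem IsMeanEnergyMinimiser.slope_le_meanEnergy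
    (h : ω.IsMeanEnergyMinimiser (FermionInteraction.pencil Ψ₀ Ψ₁ σ) R) {t : ℝ} (ht : σ < t) :
    slope (fun s => (FermionInteraction.pencil Ψ₀ Ψ₁ s).tiGroundEnergyDensity R) σ t ≤ ω.meanEnergy Ψ₁ R := by
  have key := h.secant_right_le_meanEnergy (δ := t - σ) (sub_pos.2 ht)
  rw [add_sub_cancel] at key
  simp only [slope_def_field]
  exact key

/-- Left slopes lie above the conjugate density of a minimiser: `e_{Ψ₁}(ω) ≤ slope e₀ σ t` for `t < σ`.
[cite: Griffiths1966, §II] -/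
theorem IsMeanEnergyMinimiser.meanEnergy_le_slope
    (h : ω.IsMeanEnergyMinimiser (FermionInteraction.pencil Ψ₀ Ψ₁ σ) R) {t : ℝ} (ht : t < σ) :
    ω.meanEnergy Ψ₁ R ≤ slope (fun s => (FermionInteraction.pencil Ψ₀ Ψ₁ s).tiGroundEnergyDensity R) σ t := by
  have key := h.meanEnergy_le_secant_left (δ := σ - t) (sub_pos.2 ht)
  rw [sub_sub_cancel] at key
  rw [slope_comm]
  simp only [slope_def_field]
  exact key

/-- **RANGE, lower end**: `∂⁺e₀(σ) ≤ e_{Ψ₁}(ω)` for every minimiser `ω` of `Ψ₀ + σΨ₁`.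
[cite: Israel1979, §II.1 eq. (1)–(2)] -/
theorem IsMeanEnergyMinimiser.rightDeriv_le_meanEnergy
    (h : ω.IsMeanEnergyMinimiser (FermionInteraction.pencil Ψ₀ Ψ₁ σ) R) :
    derivWithin (fun s => (FermionInteraction.pencil Ψ₀ Ψ₁ s).tiGroundEnergyDensity R) (Ioi σ) σ ≤
      ω.meanEnergy Ψ₁ R :=
  le_of_tendsto (FermionInteraction.tendsto_slope_nhdsGT_tiGroundEnergyDensity_pencil Ψ₀ Ψ₁ R σ)
    (eventually_nhdsWithin_of_forall fun _ ht => h.slope_le_meanEnergy ht)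

/-- **RANGE, upper end**: `e_{Ψ₁}(ω) ≤ ∂⁻e₀(σ)` for every minimiser `ω` of `Ψ₀ + σΨ₁`.
[cite: Israel1979, §II.1 eq. (1)–(2)] -/
theorem IsMeanEnergyMinimiser.meanEnergy_le_leftDeriv
    (h : ω.IsMeanEnergyMinimiser (FermionInteraction.pencil Ψ₀ Ψ₁ σ) R) :
    ω.meanEnergy Ψ₁ R ≤
      derivWithin (fun s => (FermionInteraction.pencil Ψ₀ Ψ₁ s).tiGroundEnergyDensity R) (Iio σ) σ :=
  ge_of_tendsto (FermionInteraction.tendsto_slope_nhdsLT_tiGroundEnergyDensity_pencil Ψ₀ Ψ₁ R σ)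
    (eventually_nhdsWithin_of_forall fun _ ht => h.meanEnergy_le_slope ht)

/-- **UNIQUENESS at a differentiability point**: if `s ↦ e₀(Ψ₀ + sΨ₁)` has derivative `f'` at `σ`, every
minimiser at `σ` has conjugate density `e_{Ψ₁}(ω) = f'` (Griffiths: all translation-invariant ground states
agree on the conjugate observable off the kinks). [cite: Griffiths1966, §II] -/
theorem IsMeanEnergyMinimiser.meanEnergy_eq_of_hasDerivAt
    (h : ω.IsMeanEnergyMinimiser (FermionInteraction.pencil Ψ₀ Ψ₁ σ) R) {f' : ℝ}
    (hf : HasDerivAt (fun s => (FermionInteraction.pencil Ψ₀ Ψ₁ s).tiGroundEnergyDensity R) f' σ) :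
    ω.meanEnergy Ψ₁ R = f' := by
  have h1 : derivWithin (fun s => (FermionInteraction.pencil Ψ₀ Ψ₁ s).tiGroundEnergyDensity R) (Ioi σ) σ = f' :=
    hf.hasDerivWithinAt.derivWithin (uniqueDiffWithinAt_Ioi σ)
  have h2 : derivWithin (fun s => (FermionInteraction.pencil Ψ₀ Ψ₁ s).tiGroundEnergyDensity R) (Iio σ) σ = f' :=
    hf.hasDerivWithinAt.derivWithin (uniqueDiffWithinAt_Iio σ)
  exact le_antisymm (h2 ▸ h.meanEnergy_le_leftDeriv) (h1 ▸ h.rightDeriv_le_meanEnergy)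

end InfVolFermionState

/-! ### Both endpoints are attained -/

namespace FermionInteraction

variable (Ψ₀ Ψ₁ : FermionInteraction d) (R : ℝ)

/-- **The right derivative is ATTAINED**: some minimiser `ω` of `Ψ₀ + σΨ₁` has `e_{Ψ₁}(ω) = ∂⁺e₀(σ)` —
a weak-⋆ limit of minimisers at `σ + 1/(n+1)`, whose conjugate densities lie between the secant slopes
`slope e₀ (σ+δ) (σ+2δ)` and `slope e₀ σ (σ+δ)`, both tending to `∂⁺e₀(σ)`.
[cite: Israel1979, §II.1 eq. (1)–(2)] -/
theorem exists_isMeanEnergyMinimiser_meanEnergy_eq_rightDeriv (σ : ℝ) :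
    ∃ ω : InfVolFermionState d, ω.IsMeanEnergyMinimiser (pencil Ψ₀ Ψ₁ σ) R ∧
      ω.meanEnergy Ψ₁ R = derivWithin (fun s => (pencil Ψ₀ Ψ₁ s).tiGroundEnergyDensity R) (Ioi σ) σ := by
  set f : ℝ → ℝ := fun s => (pencil Ψ₀ Ψ₁ s).tiGroundEnergyDensity R with hf
  set δ : ℕ → ℝ := fun n => 1 / ((n : ℝ) + 1) with hδ
  have hδpos : ∀ n, 0 < δ n := fun n => by positivity
  have hδ0 : Tendsto δ atTop (𝓝 0) := tendsto_one_div_add_atTop_nhds_zero_nat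
  have hs1 : Tendsto (fun n => σ + δ n) atTop (𝓝 σ) := by
    simpa using (tendsto_const_nhds (x := σ)).add hδ0
  have hs2 : Tendsto (fun n => σ + 2 * δ n) atTop (𝓝 σ) := by
    simpa using (tendsto_const_nhds (x := σ)).add (hδ0.const_mul 2)
  choose ω hω using fun n => (pencil Ψ₀ Ψ₁ (σ + δ n)).exists_isMeanEnergyMinimiser R
  -- the squeeze
  have hup : ∀ n, (ω n).meanEnergy Ψ₁ R ≤ slope f σ (σ + δ n) := fun n => by
    have key := (hω n).meanEnergy_le_slope (t := σ) (by linarith [hδpos n])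
    rwa [slope_comm] at key
  have hlo : ∀ n, slope f (σ + δ n) (σ + 2 * δ n) ≤ (ω n).meanEnergy Ψ₁ R := fun n =>
    (hω n).slope_le_meanEnergy (by linarith [hδpos n])
  have hT := tendsto_slope_nhdsGT_tiGroundEnergyDensity_pencil Ψ₀ Ψ₁ R σ
  have h1 : Tendsto (fun n => slope f σ (σ + δ n)) atTop (𝓝 (derivWithin f (Ioi σ) σ)) :=
    hT.comp (tendsto_nhdsWithin_of_tendsto_nhds_of_eventually_within _ hs1
      (Eventually.of_forall fun n => show σ + δ n ∈ Ioi σ by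
        simp only [mem_Ioi]; linarith [hδpos n]))
  have h2 : Tendsto (fun n => slope f σ (σ + 2 * δ n)) atTop (𝓝 (derivWithin f (Ioi σ) σ)) :=
    hT.comp (tendsto_nhdsWithin_of_tendsto_nhds_of_eventually_within _ hs2
      (Eventually.of_forall fun n => show σ + 2 * δ n ∈ Ioi σ by
        simp only [mem_Ioi]; linarith [hδpos n]))
  have h3 : Tendsto (fun n => slope f (σ + δ n) (σ + 2 * δ n)) atTop (𝓝 (derivWithin f (Ioi σ) σ)) := by
    have key := (h2.const_mul 2).sub h1
    rw [show 2 * derivWithin f (Ioi σ) σ - derivWithin f (Ioi σ) σ = derivWithin f (Ioi σ) σ by ring] at key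
    exact key.congr fun n => (slope_two_step f σ (δ n) (hδpos n).ne').symm
  have hb : Tendsto (fun n => (ω n).meanEnergy Ψ₁ R) atTop (𝓝 (derivWithin f (Ioi σ) σ)) :=
    tendsto_of_tendsto_of_tendsto_of_le_of_le h3 h1 hlo hup
  -- a convergent subsequence of minimisers
  obtain ⟨φ, hφ, ωl, hlim, hmin⟩ :=
    InfVolFermionState.exists_tendsto_expect_subseq_isMeanEnergyMinimiser_pencil hs1 ω hω
  exact ⟨ωl, hmin, tendsto_nhds_unique (InfVolFermionState.tendsto_meanEnergy_of_tendsto_expect hlim Ψ₁ R)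
    (hb.comp hφ.tendsto_atTop)⟩

/-- **The left derivative is ATTAINED**: some minimiser `ω` of `Ψ₀ + σΨ₁` has `e_{Ψ₁}(ω) = ∂⁻e₀(σ)`
(weak-⋆ limit of minimisers at `σ − 1/(n+1)`). [cite: Israel1979, §II.1 eq. (1)–(2)] -/
theorem exists_isMeanEnergyMinimiser_meanEnergy_eq_leftDeriv (σ : ℝ) :
    ∃ ω : InfVolFermionState d, ω.IsMeanEnergyMinimiser (pencil Ψ₀ Ψ₁ σ) R ∧
      ω.meanEnergy Ψ₁ R = derivWithin (fun s => (pencil Ψ₀ Ψ₁ s).tiGroundEnergyDensity R) (Iio σ) σ := by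
  set f : ℝ → ℝ := fun s => (pencil Ψ₀ Ψ₁ s).tiGroundEnergyDensity R with hf
  set δ : ℕ → ℝ := fun n => 1 / ((n : ℝ) + 1) with hδ
  have hδpos : ∀ n, 0 < δ n := fun n => by positivity
  have hδ0 : Tendsto δ atTop (𝓝 0) := tendsto_one_div_add_atTop_nhds_zero_nat
  have hs1 : Tendsto (fun n => σ + -δ n) atTop (𝓝 σ) := by
    simpa using (tendsto_const_nhds (x := σ)).add hδ0.neg
  have hs2 : Tendsto (fun n => σ + 2 * -δ n) atTop (𝓝 σ) := by
    simpa using (tendsto_const_nhds (x := σ)).add (hδ0.neg.const_mul 2)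
  choose ω hω using fun n => (pencil Ψ₀ Ψ₁ (σ + -δ n)).exists_isMeanEnergyMinimiser R
  -- the squeeze
  have hlo : ∀ n, slope f σ (σ + -δ n) ≤ (ω n).meanEnergy Ψ₁ R := fun n => by
    have key := (hω n).slope_le_meanEnergy (t := σ) (by linarith [hδpos n])
    rwa [slope_comm] at key
  have hup : ∀ n, (ω n).meanEnergy Ψ₁ R ≤ slope f (σ + -δ n) (σ + 2 * -δ n) := fun n =>
    (hω n).meanEnergy_le_slope (by linarith [hδpos n])
  have hT := tendsto_slope_nhdsLT_tiGroundEnergyDensity_pencil Ψ₀ Ψ₁ R σ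
  have h1 : Tendsto (fun n => slope f σ (σ + -δ n)) atTop (𝓝 (derivWithin f (Iio σ) σ)) :=
    hT.comp (tendsto_nhdsWithin_of_tendsto_nhds_of_eventually_within _ hs1
      (Eventually.of_forall fun n => show σ + -δ n ∈ Iio σ by
        simp only [mem_Iio]; linarith [hδpos n]))
  have h2 : Tendsto (fun n => slope f σ (σ + 2 * -δ n)) atTop (𝓝 (derivWithin f (Iio σ) σ)) :=
    hT.comp (tendsto_nhdsWithin_of_tendsto_nhds_of_eventually_within _ hs2
      (Eventually.of_forall fun n => show σ + 2 * -δ n ∈ Iio σ by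
        simp only [mem_Iio]; linarith [hδpos n]))
  have h3 : Tendsto (fun n => slope f (σ + -δ n) (σ + 2 * -δ n)) atTop (𝓝 (derivWithin f (Iio σ) σ)) := by
    have key := (h2.const_mul 2).sub h1
    rw [show 2 * derivWithin f (Iio σ) σ - derivWithin f (Iio σ) σ = derivWithin f (Iio σ) σ by ring] at key
    exact key.congr fun n => (slope_two_step f σ (-δ n) (neg_ne_zero.2 (hδpos n).ne')).symm
  have hb : Tendsto (fun n => (ω n).meanEnergy Ψ₁ R) atTop (𝓝 (derivWithin f (Iio σ) σ)) :=
    tendsto_of_tendsto_of_tendsto_of_le_of_le h1 h3 hlo hup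
  obtain ⟨φ, hφ, ωl, hlim, hmin⟩ :=
    InfVolFermionState.exists_tendsto_expect_subseq_isMeanEnergyMinimiser_pencil hs1 ω hω
  exact ⟨ωl, hmin, tendsto_nhds_unique (InfVolFermionState.tendsto_meanEnergy_of_tendsto_expect hlim Ψ₁ R)
    (hb.comp hφ.tendsto_atTop)⟩

/-- **The set of conjugate densities of the minimisers at `σ` has LEAST element `∂⁺e₀(σ)`.**
[cite: Israel1979, §II.1 eq. (1)–(2)] -/
theorem isLeast_meanEnergy_minimisers_rightDeriv (σ : ℝ) :
    IsLeast ((fun ω : InfVolFermionState d => ω.meanEnergy Ψ₁ R) ''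
        {ω | ω.IsMeanEnergyMinimiser (pencil Ψ₀ Ψ₁ σ) R})
      (derivWithin (fun s => (pencil Ψ₀ Ψ₁ s).tiGroundEnergyDensity R) (Ioi σ) σ) := by
  obtain ⟨ω, hω, hωe⟩ := exists_isMeanEnergyMinimiser_meanEnergy_eq_rightDeriv Ψ₀ Ψ₁ R σ
  refine ⟨⟨ω, hω, hωe⟩, ?_⟩
  rintro _ ⟨ω', hω', rfl⟩
  exact hω'.rightDeriv_le_meanEnergy

/-- **The set of conjugate densities of the minimisers at `σ` has GREATEST element `∂⁻e₀(σ)`.**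
[cite: Israel1979, §II.1 eq. (1)–(2)] -/
theorem isGreatest_meanEnergy_minimisers_leftDeriv (σ : ℝ) :
    IsGreatest ((fun ω : InfVolFermionState d => ω.meanEnergy Ψ₁ R) ''
        {ω | ω.IsMeanEnergyMinimiser (pencil Ψ₀ Ψ₁ σ) R})
      (derivWithin (fun s => (pencil Ψ₀ Ψ₁ s).tiGroundEnergyDensity R) (Iio σ) σ) := by
  obtain ⟨ω, hω, hωe⟩ := exists_isMeanEnergyMinimiser_meanEnergy_eq_leftDeriv Ψ₀ Ψ₁ R σ
  refine ⟨⟨ω, hω, hωe⟩, ?_⟩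
  rintro _ ⟨ω', hω', rfl⟩
  exact hω'.meanEnergy_le_leftDeriv

/-- **Differentiability ⟺ uniqueness of the conjugate density**: `s ↦ e₀(Ψ₀ + sΨ₁)` is differentiable
at `σ` iff all minimisers at `σ` have the same conjugate density `e_{Ψ₁}` (a kink of the ground-state
energy density is exactly the coexistence of translation-invariant ground states with different conjugate
densities). [cite: Griffiths1966, §II] -/
theorem differentiableAt_tiGroundEnergyDensity_pencil_iff (σ : ℝ) :
    DifferentiableAt ℝ (fun s => (pencil Ψ₀ Ψ₁ s).tiGroundEnergyDensity R) σ ↔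
      ∀ ω ω' : InfVolFermionState d, ω.IsMeanEnergyMinimiser (pencil Ψ₀ Ψ₁ σ) R →
        ω'.IsMeanEnergyMinimiser (pencil Ψ₀ Ψ₁ σ) R → ω.meanEnergy Ψ₁ R = ω'.meanEnergy Ψ₁ R := by
  constructor
  · intro hd ω ω' hω hω'
    rw [hω.meanEnergy_eq_of_hasDerivAt hd.hasDerivAt, hω'.meanEnergy_eq_of_hasDerivAt hd.hasDerivAt]
  · intro hall
    obtain ⟨ωp, hωp, hep⟩ := exists_isMeanEnergyMinimiser_meanEnergy_eq_rightDeriv Ψ₀ Ψ₁ R σ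
    obtain ⟨ωm, hωm, hem⟩ := exists_isMeanEnergyMinimiser_meanEnergy_eq_leftDeriv Ψ₀ Ψ₁ R σ
    have heq : derivWithin (fun s => (pencil Ψ₀ Ψ₁ s).tiGroundEnergyDensity R) (Iio σ) σ =
        derivWithin (fun s => (pencil Ψ₀ Ψ₁ s).tiGroundEnergyDensity R) (Ioi σ) σ := by
      rw [← hem, ← hep, hall ωm ωp hωm hωp]
    obtain ⟨hR, hL⟩ := hasDerivWithinAt_Ioi_Iio_tiGroundEnergyDensity_pencil Ψ₀ Ψ₁ R σ
    rw [heq] at hL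
    have hslL := (hasDerivWithinAt_iff_tendsto_slope' self_notMem_Iio).1 hL
    have hslR := (hasDerivWithinAt_iff_tendsto_slope' self_notMem_Ioi).1 hR
    exact (hasDerivAt_iff_tendsto_slope_left_right.2 ⟨hslL, hslR⟩).differentiableAt

end FermionInteraction

end Literature.MathematicalPhysics.QuantumLattice

end
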